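import Literature.Analysis.FluidPDE.ElgindiEllipticWeakExistence
import Literature.Analysis.FluidPDE.ElgindiAngularHardy
import Literature.Analysis.FluidPDE.ElgindiSliceBounds
import Literature.Analysis.FluidPDE.ElgindiStripCalculusTwo
import Mathlib.MeasureTheory.Function.ConvergenceInMeasure
import Mathlib.Analysis.SpecialFunctions.Integrability.Basic
import HarnessLib

/-!
# Boundary values of the slices of the weak solution: the Hardy bound on the energy space
([Elgindi2021] §7.2 Lemma 7.2 and §7.1 Proposition 7.1)

Topic `Literature/Analysis/FluidPDE`. Proof file (everything proved, no definitions, no named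
facts) on the proof path of the named fact
`Literature.Analysis.FluidPDE.Elgindi.ElgindiGhoulMasmoudi2021_stabilityCore`
(`ElgindiStabilityDecomposition.lean`). T. M. Elgindi, Ann. of Math. 194 (2021) =
arXiv:1904.04795, §7.2 Lemma 7.2 (p. 20: the angular Hardy inequality
`∫|f|²/sin²(2θ) ≤ 10∫|f′|²` for `f(0) = f(π/2) = 0`) and §7.1 Proposition 7.1 (p. 19).

* `lintegral_hardy_weakSpace`: the Hardy bound `∫∫_strip U₀²/sin²(2θ) ≤ 10‖U₂‖²` holds on the
  whole energy space (on graphs by Lemma 7.2 slice by slice; it passes to the closure by Fatou).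
  This encodes the Dirichlet conditions `Ψ(R,0) = Ψ(R,π/2) = 0` of the weak solution.
* One-dimensional consequences for a slice `y ∈ C¹(0,π/2)` with `y′ ∈ L²`: `y` has one-sided limits
  at `0⁺` and `(π/2)⁻` (`exists_tendsto_of_sq_integrable_deriv`), and they vanish as soon as
  `y²/sin²(2θ)` is integrable (`tendsto_zero_of_hardy_integrable`).
-/

noncomputable section

open MeasureTheory Set Real Filter Function
open _root_.Topology
open scoped ENNReal InnerProductSpace ContDiff

namespace Literature.Analysis.FluidPDE

namespace Elgindi

/-! ### The Hardy bound on graphs -/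

/-- Slices of the test class vanish at `θ = 0` and `θ = π/2` and satisfy Lemma 7.2, with an
integrable singular integrand. [cite: Elgindi2021, §7.2 Lemma 7.2 (p. 20 of arXiv:1904.04795)] -/
theorem hardy_slice {Ψ : ℝ → ℝ → ℝ} (hΨ : ContDiff ℝ 1 (uncurry Ψ)) (hD0 : ∀ R, Ψ R 0 = 0) (hD1 : ∀ R, Ψ R (π / 2) = 0) (R : ℝ) :
    IntegrableOn (fun θ => Ψ R θ ^ 2 / Real.sin (2 * θ) ^ 2) (Ioo 0 (π / 2)) ∧
    ∫ θ in Ioo 0 (π / 2), Ψ R θ ^ 2 / Real.sin (2 * θ) ^ 2 ≤ 10 * ∫ θ in Ioo 0 (π / 2), dθ Ψ R θ ^ 2 := by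
  have hy : ContDiff ℝ 1 fun θ => Ψ R θ := hΨ.comp (contDiff_const.prodMk contDiff_id)
  have hH := angularHardy hy (hD0 R) (hD1 R)
  have hdu : deriv (fun θ => Ψ R θ) = fun θ => dθ Ψ R θ := rfl
  rw [hdu, intervalIntegral.integral_of_le (by positivity), intervalIntegral.integral_of_le (by positivity),
    integral_Ioc_eq_integral_Ioo, integral_Ioc_eq_integral_Ioo] at hH
  -- integrability: `|Ψ(R,θ)| ≤ Mθ` near `0` and `≤ M′(π/2−θ)` near `π/2`, and `sin(2θ) ≥ (4/π)·min(θ, π/2−θ)`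
  obtain ⟨M, hM0, hM⟩ := exists_abs_le_mul_of_deriv hy (hD0 R) (π / 2)
  set g : ℝ → ℝ := fun s => Ψ R (π / 2 - s) with hg
  have hgc : ContDiff ℝ 1 g := hy.comp (contDiff_const.sub contDiff_id)
  have hg0 : g 0 = 0 := by simp [hg, hD1 R]
  obtain ⟨M', hM'0, hM'⟩ := exists_abs_le_mul_of_deriv hgc hg0 (π / 2)
  have hyc : Continuous fun θ => Ψ R θ := hy.continuous
  have hmeas : AEStronglyMeasurable (fun θ => Ψ R θ ^ 2 / Real.sin (2 * θ) ^ 2) (volume.restrict (Ioo 0 (π / 2))) := by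
    refine (ContinuousOn.div ((hyc.pow 2).continuousOn) ((by fun_prop : Continuous fun θ => Real.sin (2 * θ) ^ 2).continuousOn)
      fun θ hθ => ?_).aestronglyMeasurable measurableSet_Ioo
    have : 0 < Real.sin (2 * θ) := Real.sin_pos_of_pos_of_lt_pi (by linarith [hθ.1]) (by linarith [hθ.2])
    positivity
  have hbound : ∀ θ ∈ Ioo 0 (π / 2), Ψ R θ ^ 2 / Real.sin (2 * θ) ^ 2 ≤ (max M M') ^ 2 * (π / 4) ^ 2 := by
    intro θ hθ
    have hs : 0 < Real.sin (2 * θ) := Real.sin_pos_of_pos_of_lt_pi (by linarith [hθ.1]) (by linarith [hθ.2])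
    rw [div_le_iff₀ (by positivity)]
    rcases le_or_gt θ (π / 4) with h4 | h4
    · -- near `0`: `|Ψ| ≤ Mθ`, `sin 2θ ≥ (4/π)θ`
      have h1 := hM θ (by rw [abs_of_pos hθ.1]; exact hθ.2.le)
      rw [abs_of_pos hθ.1] at h1
      have h2 := four_div_pi_mul_le_sin_two_mul hθ.1.le h4
      have h3 : |Ψ R θ| ≤ max M M' * θ := h1.trans (mul_le_mul_of_nonneg_right (le_max_left _ _) hθ.1.le)
      have h5 : (max M M' * θ) ^ 2 ≤ (max M M') ^ 2 * (π / 4) ^ 2 * Real.sin (2 * θ) ^ 2 := by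
        have : θ ≤ π / 4 * Real.sin (2 * θ) := by
          have := h2; rw [div_mul_eq_mul_div, div_le_iff₀ Real.pi_pos] at this
          nlinarith [Real.pi_pos]
        calc (max M M' * θ) ^ 2 = (max M M') ^ 2 * θ ^ 2 := by ring
          _ ≤ (max M M') ^ 2 * (π / 4 * Real.sin (2 * θ)) ^ 2 := by
              gcongr
              exact hθ.1.le
          _ = _ := by ring
      calc Ψ R θ ^ 2 = |Ψ R θ| ^ 2 := (sq_abs _).symm
        _ ≤ (max M M' * θ) ^ 2 := pow_le_pow_left₀ (abs_nonneg _) h3 2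
        _ ≤ _ := h5
    · -- near `π/2`: `|Ψ| ≤ M′(π/2 − θ)`, `sin 2θ ≥ (4/π)(π/2 − θ)`
      have hs' : π / 2 - θ ∈ Icc 0 (π / 2) := ⟨by linarith [hθ.2], by linarith [hθ.1]⟩
      have h1 := hM' (π / 2 - θ) (by rw [abs_of_nonneg hs'.1]; exact hs'.2)
      have e : g (π / 2 - θ) = Ψ R θ := by simp [hg]
      rw [e, abs_of_nonneg hs'.1] at h1
      have h2 := four_div_pi_mul_sub_le_sin_two_mul h4.le hθ.2.le
      have h3 : |Ψ R θ| ≤ max M M' * (π / 2 - θ) := h1.trans (mul_le_mul_of_nonneg_right (le_max_right _ _) hs'.1)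
      have h5 : (max M M' * (π / 2 - θ)) ^ 2 ≤ (max M M') ^ 2 * (π / 4) ^ 2 * Real.sin (2 * θ) ^ 2 := by
        have : π / 2 - θ ≤ π / 4 * Real.sin (2 * θ) := by
          have := h2; rw [div_mul_eq_mul_div, div_le_iff₀ Real.pi_pos] at this
          nlinarith [Real.pi_pos]
        calc (max M M' * (π / 2 - θ)) ^ 2 = (max M M') ^ 2 * (π / 2 - θ) ^ 2 := by ring
          _ ≤ (max M M') ^ 2 * (π / 4 * Real.sin (2 * θ)) ^ 2 := by
              gcongr
              exact hs'.1
          _ = _ := by ring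
      calc Ψ R θ ^ 2 = |Ψ R θ| ^ 2 := (sq_abs _).symm
        _ ≤ (max M M' * (π / 2 - θ)) ^ 2 := pow_le_pow_left₀ (abs_nonneg _) h3 2
        _ ≤ _ := h5
  have hI : IntegrableOn (fun θ => Ψ R θ ^ 2 / Real.sin (2 * θ) ^ 2) (Ioo 0 (π / 2)) := by
    refine Integrable.mono' (integrableOn_const (by simp) : IntegrableOn (fun _ => (max M M') ^ 2 * (π / 4) ^ 2) (Ioo 0 (π / 2)) volume)
      hmeas ?_
    rw [ae_restrict_iff' measurableSet_Ioo]
    refine ae_of_all _ fun θ hθ => ?_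
    rw [Real.norm_eq_abs, abs_of_nonneg (by positivity)]
    exact hbound θ hθ
  exact ⟨hI, hH⟩

/-- The singular integrand is measurable for continuous `Ψ`. [folklore] -/
theorem measurable_sq_div_sin_sq {Ψ : ℝ × ℝ → ℝ} (hΨ : Measurable Ψ) :
    Measurable fun p : ℝ × ℝ => Ψ p ^ 2 / Real.sin (2 * p.2) ^ 2 :=
  (hΨ.pow_const 2).div ((Real.continuous_sin.measurable.comp (measurable_const.mul measurable_snd)).pow_const 2)

/-- **The Hardy bound on graphs, strip form**: `∫∫_strip Ψ²/sin²(2θ) ≤ 10∫∫_strip (∂_θΨ)²` for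
`Ψ = cos θχ` in the test class (as an inequality of extended reals). [cite: Elgindi2021, §7.2 Lemma 7.2 (p. 20 of arXiv:1904.04795)] -/
theorem lintegral_hardy_graphElt (α : ℝ) {χ : ℝ → ℝ → ℝ} (hχ : χ ∈ orthClass) :
    ∫⁻ p in strip, ENNReal.ofReal ((graphElt α χ 0 : ℝ × ℝ → ℝ) p ^ 2 / Real.sin (2 * p.2) ^ 2) ≤
      ENNReal.ofReal (10 * ‖graphElt α χ 2‖ ^ 2) := by
  obtain ⟨hsm, hs, -, hχ0, -⟩ := hχ
  have h1 : ContDiff ℝ 1 (uncurry χ) := hsm 1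
  obtain ⟨Ψ, hΨ⟩ : ∃ Ψ : ℝ → ℝ → ℝ, Ψ = fun R θ => Real.cos θ * χ R θ := ⟨_, rfl⟩
  have hΨ1 : ContDiff ℝ 1 (uncurry Ψ) := by rw [hΨ]; exact contDiff_cosProfile h1
  have hΨs : HasCompactSupport (uncurry Ψ) := by rw [hΨ]; exact hasCompactSupport_cosProfile hs
  have hD0 : ∀ R, Ψ R 0 = 0 := fun R => by rw [hΨ]; simp [hχ0 R]
  have hD1 : ∀ R, Ψ R (π / 2) = 0 := fun R => by rw [hΨ]; simp
  have g0 : ∀ p : ℝ × ℝ, graphFn α χ 0 p = Ψ p.1 p.2 := fun p => by rw [hΨ]; rfl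
  have g2 : ∀ p : ℝ × ℝ, graphFn α χ 2 p = dθ Ψ p.1 p.2 := fun p => by
    show -Real.sin p.2 * χ p.1 p.2 + Real.cos p.2 * dθ χ p.1 p.2 = _; rw [hΨ, dθ_cosProfile h1]
  -- replace the `L²` representative by `Ψ`
  have hae := toL2_ae_eq' (memLp_graphFn h1 hs 0 (α := α))
  have eL : ∫⁻ p in strip, ENNReal.ofReal ((graphElt α χ 0 : ℝ × ℝ → ℝ) p ^ 2 / Real.sin (2 * p.2) ^ 2) =
      ∫⁻ p in strip, ENNReal.ofReal (Ψ p.1 p.2 ^ 2 / Real.sin (2 * p.2) ^ 2) := by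
    refine lintegral_congr_ae ?_
    filter_upwards [hae] with p hp
    rw [graphElt_apply, hp, g0]
  rw [eL, graphElt_apply, norm_toL2_sq (memLp_graphFn h1 hs 2)]
  simp only [g2]
  -- Tonelli, slice by slice
  have hmeas : Measurable fun p : ℝ × ℝ => ENNReal.ofReal (Ψ p.1 p.2 ^ 2 / Real.sin (2 * p.2) ^ 2) :=
    (measurable_sq_div_sin_sq (hΨ1.continuous.measurable)).ennreal_ofReal
  have hprod : (volume.restrict strip : Measure (ℝ × ℝ)) = (volume.restrict (Ioi (0:ℝ))).prod (volume.restrict (Ioo 0 (π / 2))) := by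
    rw [show strip = Ioi (0:ℝ) ×ˢ Ioo 0 (π / 2) from rfl, Measure.volume_eq_prod, Measure.prod_restrict]
  -- the `θ`-integral of `(∂_θΨ)²` as an iterated integral
  have cdθ : Continuous fun p : ℝ × ℝ => dθ Ψ p.1 p.2 := (contDiff_dθ_of_contDiff (n := 0) hΨ1).continuous
  have sY : HasCompactSupport fun p : ℝ × ℝ => dθ Ψ p.1 p.2 ^ 2 := by
    have : (fun p : ℝ × ℝ => dθ Ψ p.1 p.2 ^ 2) = fun p : ℝ × ℝ => dθ Ψ p.1 p.2 * dθ Ψ p.1 p.2 := by funext p; ring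
    rw [this]; exact (hasCompactSupport_dθ_of hΨs).mul_left
  have iY : Integrable fun p : ℝ × ℝ => dθ Ψ p.1 p.2 ^ 2 := (cdθ.pow 2).integrable_of_hasCompactSupport sY
  rw [integral_strip_eq_integral_Ioi_integral_Ioo iY]
  rw [hprod, lintegral_prod _ hmeas.aemeasurable]
  -- slice inequality
  have hslice : ∀ R, ∫⁻ θ in Ioo 0 (π / 2), ENNReal.ofReal (Ψ R θ ^ 2 / Real.sin (2 * θ) ^ 2) ≤
      ENNReal.ofReal (10 * ∫ θ in Ioo 0 (π / 2), dθ Ψ R θ ^ 2) := by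
    intro R
    obtain ⟨hI, hle⟩ := hardy_slice hΨ1 hD0 hD1 R
    rw [← ofReal_integral_eq_lintegral_ofReal hI (ae_of_all _ fun θ => by positivity)]
    exact ENNReal.ofReal_le_ofReal hle
  have hnn : ∀ R, 0 ≤ ∫ θ in Ioo 0 (π / 2), dθ Ψ R θ ^ 2 := fun R => setIntegral_nonneg measurableSet_Ioo fun θ _ => sq_nonneg _
  have iInner : Integrable (fun R => ∫ θ in Ioo 0 (π / 2), dθ Ψ R θ ^ 2) (volume.restrict (Ioi (0:ℝ))) := by
    have := iY.integrableOn (s := strip)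
    rw [IntegrableOn, hprod] at this
    exact this.integral_prod_left
  calc ∫⁻ R in Ioi 0, ∫⁻ θ in Ioo 0 (π / 2), ENNReal.ofReal (Ψ (R, θ).1 (R, θ).2 ^ 2 / Real.sin (2 * (R, θ).2) ^ 2)
      ≤ ∫⁻ R in Ioi 0, ENNReal.ofReal (10 * ∫ θ in Ioo 0 (π / 2), dθ Ψ R θ ^ 2) := lintegral_mono fun R => hslice R
    _ = ENNReal.ofReal (∫ R in Ioi 0, 10 * ∫ θ in Ioo 0 (π / 2), dθ Ψ R θ ^ 2) := by
        rw [← ofReal_integral_eq_lintegral_ofReal (iInner.const_mul 10) (ae_of_all _ fun R => by have := hnn R; positivity)]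
    _ = ENNReal.ofReal (10 * ∫ R in Ioi 0, ∫ θ in Ioo 0 (π / 2), dθ Ψ R θ ^ 2) := by rw [MeasureTheory.integral_const_mul]

set_option maxHeartbeats 1600000 in
/-- **The Hardy bound on the energy space**: `∫∫_strip U₀²/sin²(2θ) ≤ 10‖U₂‖²` for every `U` in the
energy space (Fatou along an a.e. convergent subsequence of graphs). This is the weak form of the
Dirichlet conditions `Ψ(R,0) = Ψ(R,π/2) = 0`. [cite: Elgindi2021, §7.2 Lemma 7.2 and §7.1 Proposition 7.1 (pp. 19–20 of arXiv:1904.04795)] -/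
theorem lintegral_hardy_weakSpace {α : ℝ} {U : E4} (hU : U ∈ weakSpace α) :
    ∫⁻ p in strip, ENNReal.ofReal ((U 0 : ℝ × ℝ → ℝ) p ^ 2 / Real.sin (2 * p.2) ^ 2) ≤ ENNReal.ofReal (10 * ‖U 2‖ ^ 2) := by
  -- a sequence of graphs converging to `U`
  have hU' : U ∈ closure ((LinearMap.range (graphL α) : Set E4)) := by
    rw [← Submodule.topologicalClosure_coe]; exact hU
  obtain ⟨V, hV, hlim⟩ := mem_closure_iff_seq_limit.1 hU'
  choose χ hχ using fun n => (LinearMap.mem_range.1 (hV n))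
  have hVn : ∀ n, V n = graphElt α (χ n) := fun n => by rw [← hχ n]; rfl
  have hc : ∀ k : Fin 4, Continuous fun W : E4 => W k := fun k => (PiLp.proj 2 (𝕜 := ℝ) (fun _ : Fin 4 => L2Strip) k).continuous
  have h0 : Tendsto (fun n => V n 0) atTop (𝓝 (U 0)) := ((hc 0).tendsto U).comp hlim
  have h2 : Tendsto (fun n => ‖V n 2‖) atTop (𝓝 ‖U 2‖) := (continuous_norm.tendsto _).comp (((hc 2).tendsto U).comp hlim)
  -- a.e. convergent subsequence of the first components
  have hm := tendstoInMeasure_of_tendsto_Lp h0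
  obtain ⟨ns, hns, hae⟩ := hm.exists_seq_tendsto_ae
  -- Fatou
  set G : ℕ → ℝ × ℝ → ℝ≥0∞ := fun k p => ENNReal.ofReal ((V (ns k) 0 : ℝ × ℝ → ℝ) p ^ 2 / Real.sin (2 * p.2) ^ 2) with hG
  have hGm : ∀ k, AEMeasurable (G k) (volume.restrict strip) := fun k =>
    ((((Lp.aestronglyMeasurable (V (ns k) 0)).aemeasurable.pow_const 2).div
      ((Real.continuous_sin.measurable.comp (measurable_const.mul measurable_snd)).pow_const 2).aemeasurable)).ennreal_ofReal
  have hlim' : ∀ᵐ p ∂(volume.restrict strip), Tendsto (fun k => G k p) atTop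
      (𝓝 (ENNReal.ofReal ((U 0 : ℝ × ℝ → ℝ) p ^ 2 / Real.sin (2 * p.2) ^ 2))) := by
    filter_upwards [hae] with p hp
    exact ENNReal.tendsto_ofReal ((hp.pow 2).div_const _)
  have hF : ∫⁻ p in strip, ENNReal.ofReal ((U 0 : ℝ × ℝ → ℝ) p ^ 2 / Real.sin (2 * p.2) ^ 2) ≤ liminf (fun k => ∫⁻ p in strip, G k p) atTop := by
    calc ∫⁻ p in strip, ENNReal.ofReal ((U 0 : ℝ × ℝ → ℝ) p ^ 2 / Real.sin (2 * p.2) ^ 2)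
        = ∫⁻ p in strip, liminf (fun k => G k p) atTop := lintegral_congr_ae (by
            filter_upwards [hlim'] with p hp; exact hp.liminf_eq.symm)
      _ ≤ liminf (fun k => ∫⁻ p in strip, G k p) atTop := lintegral_liminf_le' hGm
  -- the graphs satisfy the bound, and the right-hand sides converge
  have hGk : ∀ k, ∫⁻ p in strip, G k p ≤ ENNReal.ofReal (10 * ‖V (ns k) 2‖ ^ 2) := fun k => by
    simp only [hG, hVn]; exact lintegral_hardy_graphElt α (χ (ns k)).2
  have hR : Tendsto (fun k => ENNReal.ofReal (10 * ‖V (ns k) 2‖ ^ 2)) atTop (𝓝 (ENNReal.ofReal (10 * ‖U 2‖ ^ 2))) :=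
    ENNReal.tendsto_ofReal ((((h2.comp hns.tendsto_atTop).pow 2).const_mul 10))
  calc ∫⁻ p in strip, ENNReal.ofReal ((U 0 : ℝ × ℝ → ℝ) p ^ 2 / Real.sin (2 * p.2) ^ 2)
      ≤ liminf (fun k => ∫⁻ p in strip, G k p) atTop := hF
    _ ≤ liminf (fun k => ENNReal.ofReal (10 * ‖V (ns k) 2‖ ^ 2)) atTop := liminf_le_liminf (Eventually.of_forall hGk)
    _ = ENNReal.ofReal (10 * ‖U 2‖ ^ 2) := hR.liminf_eq

/-- **`U₀/sin(2θ) ∈ L²(strip)` on the energy space.** [folklore] -/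
theorem integrableOn_sq_div_sin_sq_weakSpace {α : ℝ} {U : E4} (hU : U ∈ weakSpace α) :
    IntegrableOn (fun p : ℝ × ℝ => (U 0 : ℝ × ℝ → ℝ) p ^ 2 / Real.sin (2 * p.2) ^ 2) strip := by
  have hm : AEStronglyMeasurable (fun p : ℝ × ℝ => (U 0 : ℝ × ℝ → ℝ) p ^ 2 / Real.sin (2 * p.2) ^ 2) (volume.restrict strip) :=
    (((Lp.aestronglyMeasurable (U 0)).aemeasurable.pow_const 2).div
      ((Real.continuous_sin.measurable.comp (measurable_const.mul measurable_snd)).pow_const 2).aemeasurable).aestronglyMeasurable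
  refine ⟨hm, ?_⟩
  rw [hasFiniteIntegral_iff_ofReal (ae_of_all _ fun p => by positivity)]
  exact (lintegral_hardy_weakSpace hU).trans_lt ENNReal.ofReal_lt_top

/-! ### One-dimensional consequences: one-sided limits of a slice -/

/-- A function with square-integrable derivative on a bounded interval has an integrable derivative. [folklore] -/
theorem integrableOn_of_sq_integrableOn {g : ℝ → ℝ} {a b : ℝ} (hgc : ContinuousOn g (Ioo a b))
    (hI : IntegrableOn (fun θ => g θ ^ 2) (Ioo a b)) : IntegrableOn g (Ioo a b) := by
  have hm : AEStronglyMeasurable g (volume.restrict (Ioo a b)) := hgc.aestronglyMeasurable measurableSet_Ioo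
  have h1 : IntegrableOn (fun _ => (1:ℝ)) (Ioo a b) volume := integrableOn_const (by simp)
  refine Integrable.mono' ((h1.add hI).div_const 2) hm (ae_of_all _ fun θ => ?_)
  rw [Real.norm_eq_abs]
  show |g θ| ≤ ((1:ℝ) + g θ ^ 2) / 2
  nlinarith [sq_nonneg (|g θ| - 1), sq_abs (g θ), abs_nonneg (g θ)]

/-- **One-sided limits from `y′ ∈ L²`**: if `y` has derivative `y′` on `(a,b)`, continuous there,
with `y′ ∈ L²(a,b)`, then `y` has limits at `b⁻` and at `a⁺`. [folklore] -/
theorem exists_tendsto_of_sq_integrable_deriv {y y' : ℝ → ℝ} {a b : ℝ} (hab : a < b)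
    (hy : ∀ θ ∈ Ioo a b, HasDerivAt y (y' θ) θ) (hy'c : ContinuousOn y' (Ioo a b))
    (hI : IntegrableOn (fun θ => y' θ ^ 2) (Ioo a b)) :
    (∃ L, Tendsto y (𝓝[<] b) (𝓝 L)) ∧ ∃ L, Tendsto y (𝓝[>] a) (𝓝 L) := by
  have hI1 : IntegrableOn y' (Ioo a b) := integrableOn_of_sq_integrableOn hy'c hI
  have hIcc : IntegrableOn y' (uIcc a b) := by
    rw [uIcc_of_le hab.le]; exact (integrableOn_Icc_iff_integrableOn_Ioo (μ := volume)).2 hI1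
  set m := (a + b) / 2 with hm
  have hma : a < m := by rw [hm]; linarith
  have hmb : m < b := by rw [hm]; linarith
  have hmI : m ∈ uIcc a b := by rw [uIcc_of_le hab.le]; exact ⟨hma.le, hmb.le⟩
  set F : ℝ → ℝ := fun θ => ∫ x in m..θ, y' x with hF
  have hFc : ContinuousOn F (uIcc a b) := intervalIntegral.continuousOn_primitive_interval' hIcc.intervalIntegrable hmI
  -- `y = y m + F` on `(a,b)`
  have hyF : ∀ θ ∈ Ioo a b, y θ = y m + F θ := by
    intro θ hθ
    have hsub : uIcc m θ ⊆ Ioo a b := by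
      rcases le_total m θ with h | h
      · rw [uIcc_of_le h]; exact fun x hx => ⟨hma.trans_le hx.1, hx.2.trans_lt hθ.2⟩
      · rw [uIcc_of_ge h]; exact fun x hx => ⟨hθ.1.trans_le hx.1, hx.2.trans_lt hmb⟩
    have hii : IntervalIntegrable y' volume m θ :=
      (hI1.mono_set hsub).intervalIntegrable
    have h := intervalIntegral.integral_eq_sub_of_hasDerivAt (f := y) (f' := y') (a := m) (b := θ)
      (fun x hx => hy x (hsub hx)) hii
    rw [hF]; linarith
  refine ⟨⟨y m + F b, ?_⟩, ⟨y m + F a, ?_⟩⟩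
  · have h1 : Tendsto F (𝓝[Ioo a b] b) (𝓝 (F b)) :=
      ((hFc b (by rw [uIcc_of_le hab.le]; exact right_mem_Icc.2 hab.le)).mono (by rw [uIcc_of_le hab.le]; exact Ioo_subset_Icc_self)).tendsto
    rw [← nhdsWithin_Ioo_eq_nhdsLT hab]
    refine (tendsto_const_nhds.add h1).congr' ?_
    filter_upwards [self_mem_nhdsWithin] with θ hθ
    exact (hyF θ hθ).symm
  · have h1 : Tendsto F (𝓝[Ioo a b] a) (𝓝 (F a)) :=
      ((hFc a (by rw [uIcc_of_le hab.le]; exact left_mem_Icc.2 hab.le)).mono (by rw [uIcc_of_le hab.le]; exact Ioo_subset_Icc_self)).tendsto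
    rw [← nhdsWithin_Ioo_eq_nhdsGT hab]
    refine (tendsto_const_nhds.add h1).congr' ?_
    filter_upwards [self_mem_nhdsWithin] with θ hθ
    exact (hyF θ hθ).symm

/-- `x ↦ x⁻²` is not integrable at `0⁺`. [folklore] -/
theorem not_integrableOn_inv_sq {t : ℝ} (ht : 0 < t) : ¬IntegrableOn (fun x : ℝ => x ^ (-2:ℝ)) (Ioo 0 t) := by
  rw [intervalIntegral.integrableOn_Ioo_rpow_iff ht]; norm_num

/-- **The limit at `0⁺` vanishes under Hardy integrability.** [folklore] -/
theorem tendsto_zero_of_hardy_integrable_left {y : ℝ → ℝ} {L : ℝ} (hL : Tendsto y (𝓝[>] 0) (𝓝 L))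
    (hI : IntegrableOn (fun θ => y θ ^ 2 / Real.sin (2 * θ) ^ 2) (Ioo 0 (π / 2))) : L = 0 := by
  by_contra hne
  have hL2 : 0 < |L| / 2 := by positivity
  -- eventually `|y| ≥ |L|/2` on some `(0, δ)`
  have hev : ∀ᶠ θ in 𝓝[>] (0:ℝ), |L| / 2 ≤ |y θ| := by
    have := (hL.sub_const L)
    rw [sub_self] at this
    have h := (Metric.tendsto_nhds.1 this) (|L| / 2) hL2
    filter_upwards [h] with θ hθ
    rw [dist_zero_right, Real.norm_eq_abs] at hθ
    have := abs_sub_abs_le_abs_sub L (y θ)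
    rw [show L - y θ = -(y θ - L) by ring, abs_neg] at this
    linarith
  obtain ⟨δ, hδ, hδsub⟩ := (mem_nhdsGT_iff_exists_Ioo_subset).1 hev
  have hδ0 : 0 < δ := hδ
  set δ' := min (δ / 2) (π / 4) with hδ'
  have hδ'0 : 0 < δ' := lt_min (by linarith) (by positivity)
  have hδ'δ : δ' < δ := (min_le_left _ _).trans_lt (by linarith)
  -- on `(0, δ')` the Hardy integrand dominates `(L²/16) θ⁻²`
  have hdom : ∀ θ ∈ Ioo 0 δ', L ^ 2 / 16 * θ ^ (-2:ℝ) ≤ y θ ^ 2 / Real.sin (2 * θ) ^ 2 := by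
    intro θ hθ
    have hθδ : θ ∈ Ioo 0 δ := ⟨hθ.1, hθ.2.trans hδ'δ⟩
    have hy : |L| / 2 ≤ |y θ| := hδsub hθδ
    have hθπ : θ < π / 2 := by have := min_le_right (δ / 2) (π / 4); linarith [hθ.2, Real.pi_pos]
    have hs0 : 0 < Real.sin (2 * θ) := Real.sin_pos_of_pos_of_lt_pi (by linarith [hθ.1]) (by linarith)
    have hs1 : Real.sin (2 * θ) ≤ 2 * θ := Real.sin_le (by linarith [hθ.1])
    have e : θ ^ (-2:ℝ) = 1 / θ ^ 2 := by
      rw [Real.rpow_neg hθ.1.le, show (2:ℝ) = (2:ℕ) by norm_num, Real.rpow_natCast, one_div]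
    rw [e, le_div_iff₀ (by positivity)]
    have h4 : Real.sin (2 * θ) ^ 2 ≤ 4 * θ ^ 2 := by nlinarith
    have hy2 : L ^ 2 / 4 ≤ y θ ^ 2 := by
      have : (|L| / 2) ^ 2 ≤ |y θ| ^ 2 := pow_le_pow_left₀ (by positivity) hy 2
      rw [sq_abs, div_pow, sq_abs] at this; linarith
    calc L ^ 2 / 16 * (1 / θ ^ 2) * Real.sin (2 * θ) ^ 2 ≤ L ^ 2 / 16 * (1 / θ ^ 2) * (4 * θ ^ 2) := by
          gcongr
      _ = L ^ 2 / 4 := by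
          have hθ0 : θ ≠ 0 := hθ.1.ne'
          field_simp
          ring
      _ ≤ y θ ^ 2 := hy2
  have hIδ : IntegrableOn (fun θ : ℝ => L ^ 2 / 16 * θ ^ (-2:ℝ)) (Ioo 0 δ') := by
    refine Integrable.mono' (hI.mono_set (Ioo_subset_Ioo le_rfl (by linarith [min_le_right (δ / 2) (π / 4), Real.pi_pos]))) ?_ ?_
    · exact ((measurable_id.pow_const _).const_mul _).aestronglyMeasurable
    · rw [ae_restrict_iff' measurableSet_Ioo]
      refine ae_of_all _ fun θ hθ => ?_
      rw [Real.norm_eq_abs, abs_of_nonneg (by have := Real.rpow_nonneg hθ.1.le (-2:ℝ); positivity)]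
      exact hdom θ hθ
  have hL0 : IsUnit (L ^ 2 / 16) := isUnit_iff_ne_zero.2 (by positivity)
  have h2 : IntegrableOn (fun θ : ℝ => θ ^ (-2:ℝ)) (Ioo 0 δ') := (integrable_const_mul_iff hL0 _).1 hIδ
  exact not_integrableOn_inv_sq hδ'0 h2

/-- **The limit at `(π/2)⁻` vanishes under Hardy integrability.** [folklore] -/
theorem tendsto_zero_of_hardy_integrable_right {y : ℝ → ℝ} {L : ℝ} (hL : Tendsto y (𝓝[<] (π / 2)) (𝓝 L))
    (hI : IntegrableOn (fun θ => y θ ^ 2 / Real.sin (2 * θ) ^ 2) (Ioo 0 (π / 2))) : L = 0 := by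
  -- reflect: `z(s) = y(π/2 − s)` has limit `L` at `0⁺` and the same Hardy integrability
  set z : ℝ → ℝ := fun s => y (π / 2 - s) with hz
  have hmp : MeasurePreserving (fun s : ℝ => π / 2 - s) volume volume := volume.measurePreserving_sub_left (π / 2)
  have hme : MeasurableEmbedding fun s : ℝ => π / 2 - s := measurableEmbedding_subLeft (π / 2)
  have hpre : (fun s : ℝ => π / 2 - s) ⁻¹' Ioo 0 (π / 2) = Ioo 0 (π / 2) := by
    ext s; simp only [mem_preimage, mem_Ioo]; constructor <;> intro h <;> constructor <;> linarith [h.1, h.2]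
  have hI' : IntegrableOn (fun s => z s ^ 2 / Real.sin (2 * s) ^ 2) (Ioo 0 (π / 2)) := by
    have h := (hmp.integrableOn_comp_preimage hme (f := fun θ => y θ ^ 2 / Real.sin (2 * θ) ^ 2) (s := Ioo 0 (π / 2))).2 hI
    rw [hpre] at h
    refine h.congr (ae_of_all _ fun s => ?_)
    show y (π / 2 - s) ^ 2 / Real.sin (2 * (π / 2 - s)) ^ 2 = y (π / 2 - s) ^ 2 / Real.sin (2 * s) ^ 2
    rw [show 2 * (π / 2 - s) = π - 2 * s by ring, Real.sin_pi_sub]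
  have hL' : Tendsto z (𝓝[>] 0) (𝓝 L) := by
    have ht : Tendsto (fun s : ℝ => π / 2 - s) (𝓝[>] 0) (𝓝[<] (π / 2)) := by
      refine tendsto_nhdsWithin_iff.2 ⟨?_, ?_⟩
      · have : Tendsto (fun s : ℝ => π / 2 - s) (𝓝 0) (𝓝 (π / 2 - 0)) := (tendsto_const_nhds.sub tendsto_id)
        rw [sub_zero] at this
        exact this.mono_left nhdsWithin_le_nhds
      · filter_upwards [self_mem_nhdsWithin] with s hs
        show π / 2 - s < π / 2
        have : (0:ℝ) < s := hs
        linarith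
    exact hL.comp ht
  exact tendsto_zero_of_hardy_integrable_left hL' hI'

/-! ### Slices of a function smooth on the strip with finite Hardy and tangential energies -/

section assembly

variable {Ψ : ℝ → ℝ → ℝ} (hΨ : ContDiffOn ℝ ∞ (uncurry Ψ) strip)
  (hH : IntegrableOn (fun p : ℝ × ℝ => Ψ p.1 p.2 ^ 2 / Real.sin (2 * p.2) ^ 2) strip)
  (hH1 : IntegrableOn (fun p : ℝ × ℝ => (Dz Ψ) p.1 p.2 ^ 2 / Real.sin (2 * p.2) ^ 2) strip)
  (hT : IntegrableOn (fun p : ℝ × ℝ => dθ Ψ p.1 p.2 ^ 2) strip)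
  (hT1 : IntegrableOn (fun p : ℝ × ℝ => dθ (Dz Ψ) p.1 p.2 ^ 2) strip)

include hΨ

/-- `sin(2θ) > 0` on the strip. [folklore] -/
theorem sin_two_mul_pos_of_mem_strip {p : ℝ × ℝ} (hp : p ∈ strip) : 0 < Real.sin (2 * p.2) := by
  have := hΨ
  exact Real.sin_pos_of_pos_of_lt_pi (by linarith [hp.2.1]) (by linarith [hp.2.2])

/-- `Ψ/sin(2θ)` is `C¹` on the strip. [folklore] -/
theorem contDiffOn_div_sin : ContDiffOn ℝ 1 (uncurry fun R θ => Ψ R θ / Real.sin (2 * θ)) strip := by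
  have e : uncurry (fun R θ => Ψ R θ / Real.sin (2 * θ)) = fun p : ℝ × ℝ => uncurry Ψ p / Real.sin (2 * p.2) := by funext p; rfl
  rw [e]
  have h1 : ContDiffOn ℝ 1 (uncurry Ψ) strip := by have := contDiffOn_infty.1 hΨ 1; exact_mod_cast this
  exact h1.div (by fun_prop) fun p hp => (sin_two_mul_pos_of_mem_strip hΨ hp).ne'

omit hΨ in
/-- `∂_R(Ψ/sin 2θ) = ∂_RΨ/sin 2θ`. [folklore] -/
theorem dz_div_sin (p : ℝ × ℝ) :
    dz (fun R θ => Ψ R θ / Real.sin (2 * θ)) p.1 p.2 = dz Ψ p.1 p.2 / Real.sin (2 * p.2) := by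
  show deriv (fun R' => Ψ R' p.2 / Real.sin (2 * p.2)) p.1 = _
  rw [deriv_div_const]; rfl

include hH hH1 hT hT1

/-- **Boundary behaviour of the slices**: for every `R > 0` the slice `y = Ψ(R,·)` satisfies
`y′ ∈ L²(0,π/2)`, `y²/sin²(2θ) ∈ L¹(0,π/2)`, and `y(θ) → 0` as `θ → 0⁺` and as `θ → (π/2)⁻`.
[cite: Elgindi2021, §7.1 Proposition 7.1 and §7.2 Lemma 7.2 (pp. 19–20 of arXiv:1904.04795)] -/
theorem slice_boundary {R : ℝ} (hR : 0 < R) :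
    IntegrableOn (fun θ => dθ Ψ R θ ^ 2) (Ioo 0 (π / 2)) ∧
    IntegrableOn (fun θ => Ψ R θ ^ 2 / Real.sin (2 * θ) ^ 2) (Ioo 0 (π / 2)) ∧
    Tendsto (fun θ => Ψ R θ) (𝓝[>] 0) (𝓝 0) ∧ Tendsto (fun θ => Ψ R θ) (𝓝[<] (π / 2)) (𝓝 0) := by
  set a := R / 2
  set b := 2 * R
  have ha : 0 < a := by positivity
  have hab : a < b := by show R / 2 < 2 * R; linarith
  have hRab : R ∈ Icc a b := ⟨by show R / 2 ≤ R; linarith, by show R ≤ 2 * R; linarith⟩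
  have hQ : Ioo a b ×ˢ Ioo 0 (π / 2) ⊆ strip := fun p hp => ⟨ha.trans hp.1.1, hp.2⟩
  have hQm : MeasurableSet (Ioo a b ×ˢ Ioo (0:ℝ) (π / 2)) := measurableSet_Ioo.prod measurableSet_Ioo
  have hΨ2 : ContDiffOn ℝ 2 (uncurry Ψ) strip := by have := contDiffOn_infty.1 hΨ 2; exact_mod_cast this
  -- (a) the slice of `∂_θΨ`
  have hG1 : ContDiffOn ℝ 1 (uncurry (dθ Ψ)) strip := contDiffOn_dθ (n := 1) (by exact_mod_cast hΨ2)
  have hdz : ∀ p ∈ strip, dz (dθ Ψ) p.1 p.2 = p.1⁻¹ * dθ (Dz Ψ) p.1 p.2 := by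
    intro p hp
    have h1 := dθ_dz_eq_dz_dθ hΨ2 hp
    have h2 : dθ (Dz Ψ) p.1 p.2 = p.1 * dθ (dz Ψ) p.1 p.2 := by
      show deriv (fun θ' => p.1 * dz Ψ p.1 θ') p.2 = _
      exact deriv_const_mul_field _
    rw [← h1, h2, ← mul_assoc, inv_mul_cancel₀ (ne_of_gt hp.1), one_mul]
  have iA : IntegrableOn (fun p : ℝ × ℝ => dθ Ψ p.1 p.2 ^ 2) (Ioo a b ×ˢ Ioo 0 (π / 2)) := hT.mono_set hQ
  have iA' : IntegrableOn (fun p : ℝ × ℝ => dz (dθ Ψ) p.1 p.2 ^ 2) (Ioo a b ×ˢ Ioo 0 (π / 2)) := by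
    have hc : ContinuousOn (fun p : ℝ × ℝ => dz (dθ Ψ) p.1 p.2 ^ 2) (Ioo a b ×ˢ Ioo 0 (π / 2)) :=
      ((contDiffOn_dz (n := 0) (by simpa using hG1)).continuousOn.mono hQ).pow 2
    refine Integrable.mono' ((hT1.mono_set hQ).const_mul (a⁻¹ ^ 2)) (hc.aestronglyMeasurable hQm) ?_
    rw [ae_restrict_iff' hQm]
    refine ae_of_all _ fun p hp => ?_
    rw [Real.norm_eq_abs, abs_of_nonneg (sq_nonneg _), hdz p (hQ hp), mul_pow]
    refine mul_le_mul_of_nonneg_right ?_ (sq_nonneg _)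
    have hp1 : a < p.1 := hp.1.1
    have : p.1⁻¹ ≤ a⁻¹ := by rw [inv_le_inv₀ (ha.trans hp1) ha]; exact hp1.le
    exact pow_le_pow_left₀ (inv_nonneg.2 (ha.trans hp1).le) this 2
  obtain ⟨hY, -⟩ := integral_slice_sq_le hG1 ha hab iA iA' hRab
  -- (b) the slice of `Ψ/sin(2θ)`
  have hG2 := contDiffOn_div_sin hΨ
  have iB : IntegrableOn (fun p : ℝ × ℝ => (fun R θ => Ψ R θ / Real.sin (2 * θ)) p.1 p.2 ^ 2) (Ioo a b ×ˢ Ioo 0 (π / 2)) :=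
    (hH.mono_set hQ).congr (ae_of_all _ fun p => by simp only [div_pow])
  have iB' : IntegrableOn (fun p : ℝ × ℝ => dz (fun R θ => Ψ R θ / Real.sin (2 * θ)) p.1 p.2 ^ 2) (Ioo a b ×ˢ Ioo 0 (π / 2)) := by
    have hc : ContinuousOn (fun p : ℝ × ℝ => dz (fun R θ => Ψ R θ / Real.sin (2 * θ)) p.1 p.2 ^ 2) (Ioo a b ×ˢ Ioo 0 (π / 2)) :=
      ((contDiffOn_dz (n := 0) (by simpa using hG2)).continuousOn.mono hQ).pow 2
    refine Integrable.mono' ((hH1.mono_set hQ).const_mul (a⁻¹ ^ 2)) (hc.aestronglyMeasurable hQm) ?_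
    rw [ae_restrict_iff' hQm]
    refine ae_of_all _ fun p hp => ?_
    have hps := hQ hp
    rw [Real.norm_eq_abs, abs_of_nonneg (sq_nonneg _), dz_div_sin p]
    have hp1 : a < p.1 := hp.1.1
    have hinv : p.1⁻¹ ≤ a⁻¹ := by rw [inv_le_inv₀ (ha.trans hp1) ha]; exact hp1.le
    have e : dz Ψ p.1 p.2 = p.1⁻¹ * Dz Ψ p.1 p.2 := by
      show dz Ψ p.1 p.2 = p.1⁻¹ * (p.1 * dz Ψ p.1 p.2)
      rw [← mul_assoc, inv_mul_cancel₀ (ne_of_gt hps.1), one_mul]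
    rw [e, mul_div_assoc, mul_pow, div_pow]
    exact mul_le_mul_of_nonneg_right (pow_le_pow_left₀ (inv_nonneg.2 (ha.trans hp1).le) hinv 2) (by positivity)
  obtain ⟨hZ, -⟩ := integral_slice_sq_le hG2 ha hab iB iB' hRab
  have hZ' : IntegrableOn (fun θ => Ψ R θ ^ 2 / Real.sin (2 * θ) ^ 2) (Ioo 0 (π / 2)) :=
    hZ.congr (ae_of_all _ fun θ => by simp only [div_pow])
  -- (c) limits exist and (d) vanish
  have hy : ∀ θ ∈ Ioo (0:ℝ) (π / 2), HasDerivAt (fun θ' => Ψ R θ') (dθ Ψ R θ) θ := by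
    intro θ hθ
    have hp : (R, θ) ∈ strip := ⟨hR, hθ⟩
    have hd : DifferentiableAt ℝ (uncurry Ψ) (R, θ) := differentiableAt_of_contDiffOn_strip hΨ2 (by norm_num) hp
    have hc : HasDerivAt (fun θ' : ℝ => (R, θ')) ((0 : ℝ), (1 : ℝ)) θ := (hasDerivAt_const θ R).prodMk (hasDerivAt_id θ)
    have h := hd.hasFDerivAt.comp_hasDerivAt θ hc
    have e : (fun θ' => Ψ R θ') = uncurry Ψ ∘ fun θ' => (R, θ') := rfl
    show HasDerivAt (fun θ' => Ψ R θ') (deriv (fun θ' => Ψ R θ') θ) θ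
    rw [e, h.deriv]; exact h
  have hy'c : ContinuousOn (fun θ => dθ Ψ R θ) (Ioo 0 (π / 2)) :=
    hG1.continuousOn.comp (continuous_const.prodMk continuous_id).continuousOn fun θ hθ => ⟨hR, hθ⟩
  obtain ⟨⟨L₁, hL₁⟩, ⟨L₀, hL₀⟩⟩ := exists_tendsto_of_sq_integrable_deriv (by positivity : (0:ℝ) < π / 2) hy hy'c hY
  have e0 := tendsto_zero_of_hardy_integrable_left hL₀ hZ'
  have e1 := tendsto_zero_of_hardy_integrable_right hL₁ hZ'
  subst e0; subst e1
  exact ⟨hY, hZ', hL₀, hL₁⟩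

end assembly

end Elgindi

end Literature.Analysis.FluidPDE
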